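import Literature.NumberTheory.Automorphic.IdeleClassGroupRepAxiomOne
import Literature.NumberTheory.Automorphic.IdeleClassGaloisRepH2Cyclic
import Literature.NumberTheory.GaloisRepresentations.GlobalArtinMapAbstractExtensionProofs
import Literature.Algebra.Homology.TateTheorem
import Mathlib.RepresentationTheory.Homological.GroupCohomology.Functoriality
import HarnessLib

/-!
# Every CYCLIC layer `(Gal(E/F), C_E)` of the global class formation is a CLASS MODULE:
# `H¹(U, C_E) = 0`, `|H²(U, C_E)| = |U|` for every `U ≤ Gal(E/F)`, `H²(Gal(E/F), C_E)` cyclic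
# (Artin map), hence `IsClassModule` and Tate's theorem `Ĥⁿ(U, ℤ) ≅ Ĥⁿ⁺²(U, C_E)` — in Mathlib's
# `groupCohomology` / `tateCohomology`, for both packagings `classGalRep ≅ galoisRep` of `C_E`
# (Tate, Cassels–Fröhlich VII §9 Thm. 9.1, §11.2–11.3; Neukirch, *Bonn Lectures* I §7 (7.3))

Topic `NumberTheory/Automorphic` (idèles, idèle classes); namespace
`Literature.NumberTheory.Automorphic.IdeleClassGroup`.  Proof file: theorems only (no definition,
no named fact, no instance, no notation, no `sorry`; D-0026).

Sequel to `IdeleClassGaloisRepH2Cyclic` (door-c4: `natCard_H2_galoisRep`, `|H²(Gal(E/F), C_E)| = [E:F]`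
for cyclic `E/F`, on the packaging `galoisRep`) and `IdeleClassGroupRepAxiomOne` (door-c6: the
packaging `classGalRep`, axiom I): the bridge between the two packagings, and the passage to EVERY
SUBGROUP `U ≤ Gal(E/F)` (the layer `E/E^U`), which is what Tate's theorem consumes.

* §1 `exists_iso_galoisRep_apply_eq` — the two packagings of `C_E` as an object of `Rep ℤ Gal(E/F)`
  (`IdeleClassGroupRepAxiomOne.classGalRep`, `IdeleClassGaloisRep.galoisRep`) are the same module
  with the same action; the identity is an isomorphism `classGalRep F E ≅ galoisRep F E`, so every
  `groupCohomology` statement transfers (`nonempty_groupCohomology_iso_galoisRep`,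
  `natCard_groupCohomology_classGalRep_eq_galoisRep`).
* §2 for `E/F` CYCLIC: **`natCard_groupCohomology_two_classGalRep`** (`|H²(Gal(E/F), C_E)| =
  [E:F]` for `classGalRep`, from the tree's `natCard_H2_galoisRep` — door-c4: cyclic `H² ≅ Ĥ⁰ =
  ι(C_F)/N̄(C_E)` of order `[E:F]`, the norm index equality), `…_eq_card`, `natCard_H2_galoisRep_eq_card`
  (`= |Gal(E/F)|`).
* §3 every subgroup: `nonempty_groupCohomology_res_iso_fixedField` (`Hⁿ(U, Res C_E) ≅
  Hⁿ(Gal(E/E^U), C_E)` — the restriction to `U ≤ Gal(E/F)` IS the layer `E/E^U`), and for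
  `Gal(E/F)` cyclic **`natCard_groupCohomology_two_res_classGalRep`** /
  **`natCard_groupCohomology_two_res_galoisRep`**: `|H²(U, C_E)| = |U|` for EVERY `U ≤ Gal(E/F)` —
  hypothesis II of Neukirch's form of Tate's theorem (7.3) (the engine's `IsClassModule.of_card`).

* §4 for `E/F` cyclic: **`isAddCyclic_herbrandH0_galoisRep`** (`C_E^G/N_G C_E` is cyclic: `x ↦ [ι[x]]`
  maps `𝕀_F` onto it and kills the norm group, and `𝕀_F/Fˣ N 𝕀_E ≅ Gal(E/F)` by the tree's ARTIN MAP
  `exists_artinMap_of_isAbelianGalois`), **`isAddCyclic_H2_galoisRep`** /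
  `isAddCyclic_groupCohomology_two_classGalRep` (`H²(Gal(E/F), C_E)` is cyclic).
* §5 **`exists_isClassModule_galoisRep`** / **`exists_isClassModule_classGalRep`**: for every
  CYCLIC extension of number fields `E/F` there is a 2-cocycle `φ` (a generator `[φ]` of `H²`) with
  `IsClassModule (galoisRep F E) φ` — the engine's `IsClassModule.of_card` (Neukirch (7.3) with
  Addendum) fed with axiom I, §3 and §4; consequences by the engine's dot-lemmas:
  `nonempty_tateIso_galoisRep` (TATE'S THEOREM `Ĥⁿ(U, ℤ) ≅ Ĥⁿ⁺²(U, C_E)` for cyclic layers),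
  `isZero_groupCohomology_three_res_galoisRep` (`H³(U, C_E) = 0`),
  `nonempty_reciprocityAddEquiv_galoisRep` (`Gal(E/F)^{ab} ≃ C_E^G/N_G C_E`, abstractly).

What this is NOT: the fundamental class is not NORMALISED (no invariant map `inv : H² → ℚ/ℤ`, no
compatibility with inflation/restriction between layers, no identification of the abstract
reciprocity isomorphism with the Artin map); nothing for NON-cyclic layers (axiom II there needs
Tate's cyclic-cyclotomic splitting, Cassels–Fröhlich VII §11.2) — the next bricks of Route A.

## References
* J. W. S. Cassels, A. Fröhlich (eds.), *Algebraic Number Theory* (1967), Ch. VII (J. Tate) §8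
  Prop. 8.1, §9 Thm. 9.1 (proof: "`h(G, C_L) = n`", first and second inequalities).
  [CasselsFrohlichANT1967]
* J. Neukirch, *Class Field Theory — The Bonn Lectures* (2013), Part II §5 Lemma (5.1), Part III
  §3 (the class field axiom `|H⁰(G, C_L)| = [L:K]`, `|H¹| = 1` for cyclic layers). [Neukirch2013]
-/

noncomputable section

open CategoryTheory CategoryTheory.Limits groupCohomology

namespace Literature.NumberTheory.Automorphic

namespace IdeleClassGroup

open Literature.NumberTheory.GaloisRepresentations Literature.Algebra.Homology

/-! ## §1. The two packagings of `C_E` as a `Rep ℤ Gal(E/F)` agree -/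

section Bridge

variable (F E : Type) [Field F] [Field E] [Algebra F E] [NumberField E]

/-- **`classGalRep F E ≅ galoisRep F E`**: the tree's two packagings of the idèle class group as an
object of `Rep ℤ Gal(E/F)` (door-c6's `classGalRep`, door-c4's `galoisRep`) have the same carrier
`Additive C_E` and the same action `g ↦ classGalAct g`; the identity is an isomorphism of
representations (`Rep.mkIso` of `Representation.Equiv.mk (LinearEquiv.refl …)`), recorded as the
existence of an isomorphism that is the identity on elements. [cite: CasselsFrohlichANT1967, Ch. VII §8 (before Prop. 8.1)] -/
theorem exists_iso_galoisRep_apply_eq :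
    ∃ e : classGalRep F E ≅ galoisRep F E, ∀ x : Additive (IdeleClassGroup E), e.hom.hom x = x :=
  ⟨Rep.mkIso (ρ := (classGalRep F E).ρ) (σ := (galoisRep F E).ρ)
    (Representation.Equiv.mk
      (@LinearEquiv.refl ℤ (Additive (IdeleClassGroup E)) _ _ (AddCommGroup.toIntModule _))
      fun _ => LinearMap.ext fun _ => rfl), fun _ => rfl⟩

/-- **`Hⁿ(U, classGalRep) ≅ Hⁿ(U, galoisRep)`** for every subgroup `U ≤ Gal(E/F)` and every `n`:
cohomological statements about one packaging are statements about the other.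
[cite: CasselsFrohlichANT1967, Ch. VII §8] -/
theorem nonempty_groupCohomology_iso_galoisRep (U : Subgroup (E ≃ₐ[F] E)) (n : ℕ) :
    Nonempty (groupCohomology (Rep.res U.subtype (classGalRep F E)) n ≅
      groupCohomology (Rep.res U.subtype (galoisRep F E)) n) := by
  obtain ⟨e, -⟩ := exists_iso_galoisRep_apply_eq F E
  exact ⟨(groupCohomology.functor ℤ U n).mapIso ((Rep.resFunctor U.subtype).mapIso e)⟩

/-- `|Hⁿ(U, classGalRep)| = |Hⁿ(U, galoisRep)|`. [cite: CasselsFrohlichANT1967, Ch. VII §8] -/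
theorem natCard_groupCohomology_res_classGalRep_eq_galoisRep (U : Subgroup (E ≃ₐ[F] E)) (n : ℕ) :
    Nat.card (groupCohomology (Rep.res U.subtype (classGalRep F E)) n) =
      Nat.card (groupCohomology (Rep.res U.subtype (galoisRep F E)) n) := by
  obtain ⟨I⟩ := nonempty_groupCohomology_iso_galoisRep F E U n
  exact Nat.card_congr I.toLinearEquiv.toEquiv

/-- `|Hⁿ(Gal(E/F), classGalRep)| = |Hⁿ(Gal(E/F), galoisRep)|`. [cite: CasselsFrohlichANT1967, Ch. VII §8] -/
theorem natCard_groupCohomology_classGalRep_eq_galoisRep (n : ℕ) :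
    Nat.card (groupCohomology (classGalRep F E) n) = Nat.card (groupCohomology (galoisRep F E) n) := by
  obtain ⟨e, -⟩ := exists_iso_galoisRep_apply_eq F E
  exact Nat.card_congr ((groupCohomology.functor ℤ (E ≃ₐ[F] E) n).mapIso e).toLinearEquiv.toEquiv

end Bridge

/-! ## §2. `|H²(Gal(E/F), C_E)| = [E : F] = |Gal(E/F)|` for cyclic layers, both packagings -/

section Count

variable (F E : Type) [Field F] [Field E] [Algebra F E] [NumberField F] [NumberField E]

/-- **`|H²(Gal(E/F), C_E)| = [E : F]` for every CYCLIC extension of number fields `E/F`**, in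
Mathlib's `groupCohomology` for the `Rep` `classGalRep F E` — the tree's `natCard_H2_galoisRep`
(cyclic `H² ≅ Ĥ⁰ = C_E^G/N_G C_E = ι(C_F)/N̄(C_E)` of order `[E:F]`, the norm index equality)
transported along §1. "II" of Neukirch's form of Tate's theorem for the full group of a cyclic
layer. [cite: CasselsFrohlichANT1967, Ch. VII §9 Thm. 9.1 (proof, Step 2)][cite: Neukirch2013, Part II §5 Lemma (5.1)] -/
theorem natCard_groupCohomology_two_classGalRep [IsGalois F E] [IsCyclic (E ≃ₐ[F] E)] :
    Nat.card (groupCohomology (classGalRep F E) 2) = Module.finrank F E := by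
  rw [natCard_groupCohomology_classGalRep_eq_galoisRep, natCard_H2_galoisRep]

/-- `|H²(Gal(E/F), C_E)| = |Gal(E/F)|` for `E/F` cyclic (`classGalRep`).
[cite: CasselsFrohlichANT1967, Ch. VII §9 Thm. 9.1 (proof, Step 2)] -/
theorem natCard_groupCohomology_two_classGalRep_eq_card [IsGalois F E] [IsCyclic (E ≃ₐ[F] E)] :
    Nat.card (groupCohomology (classGalRep F E) 2) = Nat.card (E ≃ₐ[F] E) := by
  rw [natCard_groupCohomology_two_classGalRep, IsGalois.card_aut_eq_finrank]

/-- `|H²(Gal(E/F), C_E)| = |Gal(E/F)|` for `E/F` cyclic (`galoisRep`).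
[cite: CasselsFrohlichANT1967, Ch. VII §9 Thm. 9.1 (proof, Step 2)] -/
theorem natCard_H2_galoisRep_eq_card [IsGalois F E] [IsCyclic (E ≃ₐ[F] E)] :
    Nat.card (groupCohomology (galoisRep F E) 2) = Nat.card (E ≃ₐ[F] E) := by
  rw [natCard_H2_galoisRep, IsGalois.card_aut_eq_finrank]

end Count

/-! ## §3. Every subgroup: the layer `E/E^U`, and `|H²(U, C_E)| = |U|` for `Gal(E/F)` cyclic -/

section Subgroups

variable (F E : Type) [Field F] [Field E] [Algebra F E] [NumberField F] [NumberField E]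

/-- **`Hⁿ(U, Res_U C_E) ≅ Hⁿ(Gal(E/E^U), C_E)`**: the restriction of `classGalRep F E` to a subgroup
`U ≤ Gal(E/F)` is the representation `classGalRep (E^U) E` of the layer `E/E^U`, transported along
`U ≃* Gal(E/E^U)` (`IntermediateField.subgroupEquivAlgEquiv`; the action of `τ ∈ Gal(E/E^U)` on
`C_E` is that of `τ|_F`, `classGalAct_restrictScalars`); the isomorphism is Mathlib's
`groupCohomology.mapIso` of that group isomorphism and the identity of `Additive C_E`.
[cite: CasselsFrohlichANT1967, Ch. VII §1.1 and §8] -/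
theorem nonempty_groupCohomology_res_iso_fixedField (U : Subgroup (E ≃ₐ[F] E)) (n : ℕ) :
    Nonempty (groupCohomology (Rep.res U.subtype (classGalRep F E)) n ≅
      groupCohomology (classGalRep (IntermediateField.fixedField U) E) n) :=
  ⟨groupCohomology.mapIso (IntermediateField.subgroupEquivAlgEquiv U)
    (@LinearEquiv.refl ℤ (Additive (IdeleClassGroup E)) _ _ (AddCommGroup.toIntModule _))
    (fun g => LinearMap.ext fun x => by
      change (classGalRep F E).ρ (U.subtype g) x =
        (classGalRep (IntermediateField.fixedField U) E).ρ (IntermediateField.subgroupEquivAlgEquiv U g) x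
      rw [classGalRep_ρ_apply, classGalRep_ρ_apply, Subgroup.coe_subtype,
        ← classGalAct_restrictScalars (F := F) (IntermediateField.subgroupEquivAlgEquiv U g),
        restrictScalars_subgroupEquivAlgEquiv]) n⟩

/-- `|Hⁿ(U, Res_U C_E)| = |Hⁿ(Gal(E/E^U), C_E)|`. [cite: CasselsFrohlichANT1967, Ch. VII §8] -/
theorem natCard_groupCohomology_res_classGalRep (U : Subgroup (E ≃ₐ[F] E)) (n : ℕ) :
    Nat.card (groupCohomology (Rep.res U.subtype (classGalRep F E)) n) =
      Nat.card (groupCohomology (classGalRep (IntermediateField.fixedField U) E) n) := by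
  obtain ⟨I⟩ := nonempty_groupCohomology_res_iso_fixedField F E U n
  exact Nat.card_congr I.toLinearEquiv.toEquiv

/-- **`|H²(U, C_E)| = |U|` for EVERY subgroup `U` of a CYCLIC `Gal(E/F)`** (the layer `E/E^U` is
cyclic; §3 for it) — hypothesis II "`H²(g, A)` … of order `|g|` for each subgroup `g`" of
Neukirch's Tate theorem (7.3), for `A = C_E` of a cyclic layer.
[cite: Neukirch2013, Part I §7 Thm. (7.3)][cite: CasselsFrohlichANT1967, Ch. VII §9 Thm. 9.1] -/
theorem natCard_groupCohomology_two_res_classGalRep [IsGalois F E] [IsCyclic (E ≃ₐ[F] E)]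
    (U : Subgroup (E ≃ₐ[F] E)) :
    Nat.card (groupCohomology (Rep.res U.subtype (classGalRep F E)) 2) = Nat.card U := by
  haveI : IsGalois (IntermediateField.fixedField U) E :=
    IsGalois.tower_top_of_isGalois F (IntermediateField.fixedField U) E
  haveI : IsCyclic (E ≃ₐ[IntermediateField.fixedField U] E) :=
    isCyclic_of_surjective (IntermediateField.subgroupEquivAlgEquiv U)
      (IntermediateField.subgroupEquivAlgEquiv U).surjective
  rw [natCard_groupCohomology_res_classGalRep,
    natCard_groupCohomology_two_classGalRep_eq_card (IntermediateField.fixedField U) E,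
    ← Nat.card_congr (IntermediateField.subgroupEquivAlgEquiv U).toEquiv]

/-- The same for the packaging `galoisRep F E`. [cite: Neukirch2013, Part I §7 Thm. (7.3)] -/
theorem natCard_groupCohomology_two_res_galoisRep [IsGalois F E] [IsCyclic (E ≃ₐ[F] E)]
    (U : Subgroup (E ≃ₐ[F] E)) :
    Nat.card (groupCohomology (Rep.res U.subtype (galoisRep F E)) 2) = Nat.card U := by
  rw [← natCard_groupCohomology_res_classGalRep_eq_galoisRep, natCard_groupCohomology_two_res_classGalRep]

end Subgroups

/-! ## §4. A generator: `H²(Gal(E/F), C_E)` is cyclic for `E/F` cyclic (Artin reciprocity) -/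

section Cyclic

variable (F E : Type) [Field F] [Field E] [Algebra F E] [NumberField F] [NumberField E]

/-- **`Ĥ⁰(Gal(E/F), C_E) = C_E^G / N_G C_E` is a cyclic group for `E/F` cyclic.**  The map
`𝕀_F → C_E^G/N_G C_E`, `x ↦ [ι[x]]`, is onto (`C_E^G = ι(C_F)`, Tate VII §8 Prop. 8.1) and kills the
norm group `Fˣ N_{E/F} 𝕀_E` (`ι[N y] = N̄[y] ∈ N_G C_E`); so `C_E^G/N_G C_E` is a quotient of
`𝕀_F / Fˣ N_{E/F} 𝕀_E ≅ Gal(E/F)` — the ARTIN MAP of the tree's reciprocity law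
(`exists_artinMap_of_isAbelianGalois`: surjective with kernel the norm group) — hence cyclic.
[cite: CasselsFrohlichANT1967, Ch. VII §5.1 Main Theorem (B) and §8 Prop. 8.1] -/
theorem isAddCyclic_herbrandH0_galoisRep [IsGalois F E] [IsCyclic (E ≃ₐ[F] E)] :
    IsAddCyclic (Herbrand.H0 (galoisRep F E)) := by
  classical
  haveI : IsAbelianGalois F E := IsAbelianGalois.of_isCyclic F E
  -- the vectors `ι[x]`, `x ∈ 𝕀_F`, are invariant
  have hinv : ∀ x : ideleGroup F,
      Additive.ofMul (classBaseChange F E (x : IdeleClassGroup F)) ∈ (galoisRep F E).ρ.invariants :=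
    fun x => (mem_invariants_galoisRep _).2 fun g =>
      show classGalAct g (classBaseChange F E (x : IdeleClassGroup F)) = _ from
        classGalAct_classBaseChange g _
  -- `f : 𝕀_F → C_E^G / N_G C_E`, `x ↦ [ι[x]]`, as a homomorphism to the multiplicativised quotient
  let f : ideleGroup F →* Multiplicative (Herbrand.H0 (galoisRep F E)) :=
    { toFun := fun x => Multiplicative.ofAdd (Submodule.Quotient.mk ⟨_, hinv x⟩)
      map_one' := by
        have h : (⟨_, hinv 1⟩ : (galoisRep F E).ρ.invariants) = 0 := Subtype.ext (by
          change Additive.ofMul (classBaseChange F E ((1 : ideleGroup F) : IdeleClassGroup F)) = 0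
          rw [QuotientGroup.mk_one, map_one]
          rfl)
        change Multiplicative.ofAdd (Submodule.Quotient.mk (⟨_, hinv 1⟩ : (galoisRep F E).ρ.invariants)) = 1
        rw [h, Submodule.Quotient.mk_zero, ofAdd_zero]
      map_mul' := fun x y => by
        have h : (⟨_, hinv (x * y)⟩ : (galoisRep F E).ρ.invariants) = ⟨_, hinv x⟩ + ⟨_, hinv y⟩ :=
          Subtype.ext (by
            change Additive.ofMul (classBaseChange F E ((x * y : ideleGroup F) : IdeleClassGroup F)) =
              Additive.ofMul (classBaseChange F E (x : IdeleClassGroup F)) +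
                Additive.ofMul (classBaseChange F E (y : IdeleClassGroup F))
            rw [QuotientGroup.mk_mul, map_mul]
            rfl)
        change Multiplicative.ofAdd (Submodule.Quotient.mk (⟨_, hinv (x * y)⟩ : (galoisRep F E).ρ.invariants)) =
          Multiplicative.ofAdd (Submodule.Quotient.mk (⟨_, hinv x⟩ : (galoisRep F E).ρ.invariants)) *
            Multiplicative.ofAdd (Submodule.Quotient.mk (⟨_, hinv y⟩ : (galoisRep F E).ρ.invariants))
        rw [h, Submodule.Quotient.mk_add, ofAdd_add] }
  have hf_apply : ∀ x : ideleGroup F,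
      f x = Multiplicative.ofAdd (Submodule.Quotient.mk ⟨_, hinv x⟩) := fun x => rfl
  -- `f` is onto: `C_E^G = ι(C_F)` and `𝕀_F → C_F` is onto
  have hf_surj : Function.Surjective f := by
    intro q
    induction q using Submodule.Quotient.induction_on with
    | H s =>
      obtain ⟨c, hc⟩ : Additive.toMul s.1 ∈ (classBaseChange F E).range :=
        (mem_range_classBaseChange_iff (F := F) _).2 ((mem_invariants_galoisRep s.1).1 s.2)
      obtain ⟨x, rfl⟩ := QuotientGroup.mk_surjective c
      refine ⟨x, ?_⟩
      have hs : (⟨_, hinv x⟩ : (galoisRep F E).ρ.invariants) = s := Subtype.ext (by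
        change Additive.ofMul (classBaseChange F E (x : IdeleClassGroup F)) = s.1
        rw [hc]
        rfl)
      rw [hf_apply, hs]
      rfl
  -- `f` kills the norm group `Fˣ N_{E/F} 𝕀_E`
  have hf_ker : normGroup F E ≤ f.ker := by
    intro x hx
    obtain ⟨a, ha, z, hz, rfl⟩ := Subgroup.mem_sup.1 hx
    obtain ⟨w, hw⟩ := mem_idelicNormSubgroup_iff.1 hz
    rw [MonoidHom.mem_ker, hf_apply, ← ofAdd_zero]
    congr 1
    rw [Submodule.Quotient.mk_eq_zero, mem_range_normBar_iff]
    refine ⟨Additive.ofMul (w : IdeleClassGroup E), ?_⟩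
    have haz : ((a * z : ideleGroup F) : IdeleClassGroup F) = (z : IdeleClassGroup F) := by
      rw [QuotientGroup.mk_mul, (QuotientGroup.eq_one_iff a).2 ha]
      exact one_mul ((z : ideleGroup F) : IdeleClassGroup F)
    change (galoisRep F E).ρ.norm (Additive.ofMul (w : IdeleClassGroup E)) =
      Additive.ofMul (classBaseChange F E ((a * z : ideleGroup F) : IdeleClassGroup F))
    rw [norm_galoisRep_apply, haz, classBaseChange_mk, ← hw, ← classGalNorm_mk]
    rfl
  -- `𝕀_F / Fˣ N 𝕀_E ≅ Gal(E/F)` is cyclic (Artin map), and `f` factors through it, onto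
  obtain ⟨ψ, hψsurj, -, hψker, -⟩ := exists_artinMap_of_isAbelianGalois F E
  have e : ideleGroup F ⧸ normGroup F E ≃* (E ≃ₐ[F] E) :=
    (QuotientGroup.quotientMulEquivOfEq hψker).symm.trans
      (QuotientGroup.quotientKerEquivOfSurjective ψ hψsurj)
  haveI : IsCyclic (ideleGroup F ⧸ normGroup F E) := isCyclic_of_surjective e.symm e.symm.surjective
  have hlift_surj : Function.Surjective (QuotientGroup.lift (normGroup F E) f hf_ker) := by
    intro q
    obtain ⟨x, rfl⟩ := hf_surj q
    exact ⟨(x : ideleGroup F ⧸ normGroup F E), QuotientGroup.lift_mk (normGroup F E) hf_ker x⟩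
  exact isCyclic_multiplicative_iff.1 (isCyclic_of_surjective _ hlift_surj)

/-- **`H²(Gal(E/F), C_E)` is cyclic for `E/F` cyclic** (`H² ≅ Ĥ⁰` for a cyclic group, the engine's
`FiniteCyclic.normResidueCarryEquiv`, and `isAddCyclic_herbrandH0_galoisRep`).
[cite: CasselsFrohlichANT1967, Ch. VII §9 Thm. 9.1 (proof, Step 2) and §11.2] -/
theorem isAddCyclic_H2_galoisRep [IsGalois F E] [IsCyclic (E ≃ₐ[F] E)] :
    IsAddCyclic (groupCohomology (galoisRep F E) 2) := by
  obtain ⟨σ, hσ⟩ := IsCyclic.exists_generator (α := E ≃ₐ[F] E)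
  haveI := isAddCyclic_herbrandH0_galoisRep F E
  exact isAddCyclic_of_surjective (FiniteCyclic.normResidueCarryEquiv σ hσ (galoisRep F E))
    (FiniteCyclic.normResidueCarryEquiv σ hσ (galoisRep F E)).surjective

/-- `H²(Gal(E/F), C_E)` is cyclic for `E/F` cyclic — packaging `classGalRep` (§1).
[cite: CasselsFrohlichANT1967, Ch. VII §9 Thm. 9.1 (proof, Step 2)] -/
theorem isAddCyclic_groupCohomology_two_classGalRep [IsGalois F E] [IsCyclic (E ≃ₐ[F] E)] :
    IsAddCyclic (groupCohomology (classGalRep F E) 2) := by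
  haveI := isAddCyclic_H2_galoisRep F E
  obtain ⟨e, -⟩ := exists_iso_galoisRep_apply_eq F E
  let I : groupCohomology (classGalRep F E) 2 ≅ groupCohomology (galoisRep F E) 2 :=
    (groupCohomology.functor ℤ (E ≃ₐ[F] E) 2).mapIso e
  let e' : groupCohomology (galoisRep F E) 2 ≃ₗ[ℤ] groupCohomology (classGalRep F E) 2 :=
    I.symm.toLinearEquiv
  exact isAddCyclic_of_surjective e' e'.surjective

end Cyclic

/-! ## §5. Every cyclic layer of the global class formation is a class module (Tate's theorem) -/

section ClassModule

variable (F E : Type) [Field F] [Field E] [Algebra F E] [NumberField F] [NumberField E]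

/-- **Every CYCLIC layer `(Gal(E/F), C_E)` of the global class formation of number fields is a
class module**: there is a 2-cocycle `φ` (a generator `u = [φ]` of the cyclic group `H²(Gal(E/F), C_E)`
of order `[E:F]`) with `IsClassModule (galoisRep F E) φ` — I. `H¹(U, C_E) = 0` for all `U ≤ Gal(E/F)`
(axiom I, `isZero_H1_res_galoisRep`), II. `|H²(U, C_E)| = |U|` for all `U`
(`natCard_groupCohomology_two_res_galoisRep`), and `u` has order `|Gal(E/F)|` (§4 and
`natCard_H2_galoisRep`), by Neukirch's form of Tate's theorem (the engine's `IsClassModule.of_card`).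
Tate's construction of the class formation (VII §11.2) uses exactly these cyclic layers; the choice
of generator is not normalised here (no invariant map).
[cite: CasselsFrohlichANT1967, Ch. VII §9 Thm. 9.1 and §11.2][cite: Neukirch2013, Part I §7 Thm. (7.3)] -/
theorem exists_isClassModule_galoisRep [IsGalois F E] [IsCyclic (E ≃ₐ[F] E)] :
    ∃ φ : cocycles₂ (galoisRep F E), IsClassModule (galoisRep F E) φ := by
  haveI := isAddCyclic_H2_galoisRep F E
  obtain ⟨x, hx⟩ :=
    IsAddCyclic.exists_ofOrder_eq_natCard (α := groupCohomology (galoisRep F E) 2)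
  obtain ⟨φ, rfl⟩ : ∃ φ : cocycles₂ (galoisRep F E), H2π (galoisRep F E) φ = x := by
    induction x using H2_induction_on with
    | h φ => exact ⟨φ, rfl⟩
  exact ⟨φ, IsClassModule.of_card (fun U => isZero_H1_res_galoisRep U)
    (natCard_groupCohomology_two_res_galoisRep F E) (by rw [hx, natCard_H2_galoisRep_eq_card])⟩

/-- The same for the packaging `classGalRep F E` of `IdeleClassGroupRepAxiomOne`: **there is `φ`
with `IsClassModule (classGalRep F E) φ`** for every cyclic `E/F` (axiom I there:
`isZero_groupCohomology_one_res_classGalRep`).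
[cite: CasselsFrohlichANT1967, Ch. VII §9 Thm. 9.1 and §11.2][cite: Neukirch2013, Part I §7 Thm. (7.3)] -/
theorem exists_isClassModule_classGalRep [IsGalois F E] [IsCyclic (E ≃ₐ[F] E)] :
    ∃ φ : cocycles₂ (classGalRep F E), IsClassModule (classGalRep F E) φ := by
  haveI := isAddCyclic_groupCohomology_two_classGalRep F E
  obtain ⟨x, hx⟩ :=
    IsAddCyclic.exists_ofOrder_eq_natCard (α := groupCohomology (classGalRep F E) 2)
  obtain ⟨φ, rfl⟩ : ∃ φ : cocycles₂ (classGalRep F E), H2π (classGalRep F E) φ = x := by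
    induction x using H2_induction_on with
    | h φ => exact ⟨φ, rfl⟩
  exact ⟨φ, IsClassModule.of_card (isZero_groupCohomology_one_res_classGalRep F E)
    (natCard_groupCohomology_two_res_classGalRep F E)
    (by rw [hx, natCard_groupCohomology_two_classGalRep_eq_card])⟩

/-- **Tate's theorem for cyclic layers: `Ĥⁿ(U, ℤ) ≅ Ĥⁿ⁺²(U, C_E)`** for every `n ∈ ℤ` and every
subgroup `U ≤ Gal(E/F)`, `E/F` cyclic (the engine's `IsClassModule.tateIso`, Lang's `δ ∘ δ`).
[cite: Neukirch2013, Part I §7 Thm. (7.3)][cite: CasselsFrohlichANT1967, Ch. VII §11.3 (Tate's theorem)] -/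
theorem nonempty_tateIso_galoisRep [IsGalois F E] [IsCyclic (E ≃ₐ[F] E)]
    (U : Subgroup (E ≃ₐ[F] E)) [Fintype U] (n : ℤ) :
    Nonempty (tateCohomology (Rep.res U.subtype (Rep.trivial ℤ (E ≃ₐ[F] E) ℤ)) n ≅
      tateCohomology (Rep.res U.subtype (galoisRep F E)) (n + 2)) := by
  obtain ⟨φ, hA⟩ := exists_isClassModule_galoisRep F E
  exact hA.nonempty_tateIso U n

/-- **`H³(U, C_E) = 0`** for every subgroup `U ≤ Gal(E/F)` of a cyclic layer (`≅ H¹(U, ℤ) = 0`).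
[cite: Neukirch2013, Part II §1 Cor. (1.8)] -/
theorem isZero_groupCohomology_three_res_galoisRep [IsGalois F E] [IsCyclic (E ≃ₐ[F] E)]
    (U : Subgroup (E ≃ₐ[F] E)) :
    IsZero (groupCohomology (Rep.res U.subtype (galoisRep F E)) 3) := by
  obtain ⟨φ, hA⟩ := exists_isClassModule_galoisRep F E
  exact hA.isZero_groupCohomology_three_res U

/-- **The abstract reciprocity isomorphism `Gal(E/F)^{ab} ≃ C_E^G/N_G C_E`** of a cyclic layer (Tate's
theorem at `n = -2`, the engine's `IsClassModule.reciprocityAddEquiv`; NOT asserted here to be the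
Artin map — the generator is not normalised). [cite: Neukirch2013, Part I §7 (remark after Thm. (7.3))] -/
theorem nonempty_reciprocityAddEquiv_galoisRep [IsGalois F E] [IsCyclic (E ≃ₐ[F] E)] :
    Nonempty (Additive (Abelianization (E ≃ₐ[F] E)) ≃+ NormResidue (galoisRep F E)) := by
  obtain ⟨φ, hA⟩ := exists_isClassModule_galoisRep F E
  exact ⟨hA.reciprocityAddEquiv⟩

end ClassModule

end IdeleClassGroup

end Literature.NumberTheory.Automorphic

end
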